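import Literature.AlgebraicGeometry.AbelianSchemes.IsogenyRoofTransportAlongIso   -- ★ p847813 (`exists_mulEquiv_points_of_iso`, `forall_map_eq_one_iff_of_iso`, `roof_transport_along_iso`)
import Mathlib.Algebra.Group.Subgroup.Finite
import HarnessLib

/-!
# The HECKE LINES `β ↦ H_β ≤ A_y(Ω)` — a bijection onto the `𝒪`-stable order-`q` subgroups of a torsion piece — TRANSPORT along a multiplicative equivalence of
# point groups (the (a)(b)(c) clauses of the spine՚s `HeckeRoofsΩ`; [Kottwitz1992] §5, [HarrisTaylorAMS2001] §III.4)

Topic `AlgebraicGeometry/AbelianSchemes`; namespace `Literature.AlgebraicGeometry.AbelianSchemes.HeckeLines`.  THEOREMS ONLY (no definition, no named fact, no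
instance, no notation, no `sorry`); pure group theory over Mathlib `Subgroup.map`.  Cell `hodgecm-mathlib` (D-0151), P6 «MOD programme», half A line L4, E-readings leaf
`Lines/F0_P6a_EReadings.lean` socket `stub_HECKETRANS : RecordHeckeTransport` (LEAD «M-55b» (3); LA4-plan (g0) DEAL v1∕v4, seat LA4-p01 (g0) by default): the spine՚s (L4)
reading `HeckeRoofsΩ` (`Lines/F0_P6a_RGDAssembly` :83) says, at each `(e′, N′, rc₁, rc₂, x′)`, «∃ a map `β ↦ H_β` from the cosets of `Kc t₁ Kc ∕ Kc` to subgroups of `A_y(Ω)`,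
INJECTIVE, each `H_β` of order `q = p^f`, consisting of `𝔭_{c•w}`-torsion points and `𝒪_F`-stable, ONTO all such subgroups, and the roof clauses (d)(e)».  To transport
it from the E-tuple to the spread along the bridge isomorphism `ε : 𝒯_{e′,y} ≅ E_{e′,y}` (★ `exists_iso_exact_of_tupleRel_id_point`) one moves the family along
the induced MULTIPLICATIVE EQUIVALENCE of point groups `φ : E_{e′,y}(Ω) ≃* 𝒯_{e′,y}(Ω)` (★ `exists_mulEquiv_points_of_iso`): this file proves that `β ↦ φ(H_β)` keeps
(a) injectivity, (b) order ∕ torsion ∕ stability and (c) surjectivity, given that `φ` matches the torsion predicates and intertwines the endomorphism families, and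
supplies the membership riders the roof clauses (d)(e) consume (`hK`, `htors` of ★ `roof_transport_along_iso`).  `--supports stmt-HodgeConjecture-24832`, count-neutral.
HONEST LABEL: HC_CM is proved only modulo the 2 remaining named inputs (hLiu418 24832, h413 24833) until rung 0 closes; nothing here is about HC.

* `map_injective_family` (a), `card_map_eq` ∕ `forall_mem_map_tors` ∕ `forall_mem_map_stable` (b), `exists_eq_map_of_onto` (c), **`lines_transport`** ((a)(b)(c) at once,
  conclusion shaped as the `HeckeRoofsΩ` conjuncts), riders `mem_map_iff_symm_mem`, `mem_map_iff_of_iff_and` ((d): `P ∈ H_β ↔ P ∈ K_β ∧ tors P`),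
  `mem_map_iff_of_iff_tors` ((e): `P ∈ K ↔ tors P`).

## References
* [Kottwitz1992] R. Kottwitz, *Points on some Shimura varieties over finite fields*, JAMS 5 (1992), §5 (pp. 389–391) (isogeny classes ∕ lattices at `p`).
* [HarrisTaylorAMS2001] M. Harris, R. Taylor, *The geometry and cohomology of some simple Shimura varieties* (2001), §III.4, pp. 108–110 (Hecke operators as isogenies).
* [RapoportSmithlingZhang2020Diagonal] M. Rapoport, B. Smithling, W. Zhang (2020), §4.1 p. 17, §4.3 (4.23) p. 21.
* [Milne2005ShimuraVarieties] J. S. Milne, *Introduction to Shimura varieties* (2005), §14 pp. 124–125.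
-/

set_option autoImplicit false

namespace Literature.AlgebraicGeometry.AbelianSchemes

namespace HeckeLines

variable {P₁ P₂ : Type*} [Group P₁] [Group P₂] (φ : P₁ ≃* P₂) {B O : Type*}
  (tors₁ : P₁ → Prop) (tors₂ : P₂ → Prop) (act₁ : O → P₁ → P₁) (act₂ : O → P₂ → P₂)

/-- `Q ∈ φ(K) ↔ φ⁻¹ Q ∈ K` (Mathlib `Subgroup.mem_map_equiv`) — the `hK` rider of ★ `roof_transport_along_iso`. [cite: Milne2005ShimuraVarieties, §14 pp. 124–125] -/
theorem mem_map_iff_symm_mem (K : Subgroup P₁) (Q : P₂) : Q ∈ K.map φ.toMonoidHom ↔ φ.symm Q ∈ K :=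
  Subgroup.mem_map_equiv

/-- `φ P ∈ φ(K) ↔ P ∈ K`. [cite: Milne2005ShimuraVarieties, §14 pp. 124–125] -/
theorem apply_mem_map_iff (K : Subgroup P₁) (P : P₁) : φ P ∈ K.map φ.toMonoidHom ↔ P ∈ K := by
  rw [mem_map_iff_symm_mem, MulEquiv.symm_apply_apply]

/-- (a) **Injectivity of the family is kept**: `β ↦ φ(H_β)` is injective if `β ↦ H_β` is (`Subgroup.map` along an injective hom is injective).
[cite: Kottwitz1992, §5 (pp. 389–391)] -/
theorem map_injective_family (H : B → Subgroup P₁) (hinj : Function.Injective H) :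
    Function.Injective fun β => (H β).map φ.toMonoidHom :=
  fun _ _ h => hinj (Subgroup.map_injective φ.injective h)

/-- (b₁) **Orders are kept**: `|φ(K)| = |K|`. [cite: Kottwitz1992, §5 (pp. 389–391)] -/
theorem card_map_eq (K : Subgroup P₁) : Nat.card ↥(K.map φ.toMonoidHom) = Nat.card ↥K :=
  Subgroup.card_map_of_injective φ.injective

/-- (b₂) **Torsion is kept**: if `tors₂ (φ P) ↔ tors₁ P` then `φ(K)` consists of `tors₂`-points when `K` consists of `tors₁`-points.
[cite: Kottwitz1992, §5 (pp. 389–391)] -/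
theorem forall_mem_map_tors (htors : ∀ P, tors₂ (φ P) ↔ tors₁ P) (K : Subgroup P₁) (hK : ∀ P ∈ K, tors₁ P) :
    ∀ Q ∈ K.map φ.toMonoidHom, tors₂ Q := fun Q hQ => by
  rw [← φ.apply_symm_apply Q, htors]
  exact hK _ ((mem_map_iff_symm_mem φ K Q).mp hQ)

/-- (b₃) **Stability is kept**: if `act₂ a (φ P) = φ (act₁ a P)` then `φ(K)` is `act₂`-stable when `K` is `act₁`-stable. [cite: Kottwitz1992, §5 (pp. 389–391)] -/
theorem forall_mem_map_stable (hact : ∀ a P, act₂ a (φ P) = φ (act₁ a P)) (K : Subgroup P₁) (hK : ∀ a, ∀ P ∈ K, act₁ a P ∈ K) :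
    ∀ a, ∀ Q ∈ K.map φ.toMonoidHom, act₂ a Q ∈ K.map φ.toMonoidHom := fun a Q hQ => by
  rw [← φ.apply_symm_apply Q, hact, apply_mem_map_iff]
  exact hK a _ ((mem_map_iff_symm_mem φ K Q).mp hQ)

/-- (c) **Surjectivity onto the admissible subgroups is kept**: every `act₂`-stable `tors₂`-subgroup of order `q` of `P₂` is `φ(H_β)` for some `β`, if every
`act₁`-stable `tors₁`-subgroup of order `q` of `P₁` is an `H_β` (pull back along `φ⁻¹`). [cite: Kottwitz1992, §5 (pp. 389–391)] [cite: HarrisTaylorAMS2001, §III.4, pp. 108–110] -/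
theorem exists_eq_map_of_onto (htors : ∀ P, tors₂ (φ P) ↔ tors₁ P) (hact : ∀ a P, act₂ a (φ P) = φ (act₁ a P)) {q : ℕ} (H : B → Subgroup P₁)
    (honto : ∀ H' : Subgroup P₁, Nat.card ↥H' = q → (∀ P ∈ H', tors₁ P) → (∀ a, ∀ P ∈ H', act₁ a P ∈ H') → ∃ β, H β = H')
    (H₂ : Subgroup P₂) (hcard : Nat.card ↥H₂ = q) (ht : ∀ Q ∈ H₂, tors₂ Q) (hs : ∀ a, ∀ Q ∈ H₂, act₂ a Q ∈ H₂) :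
    ∃ β, (H β).map φ.toMonoidHom = H₂ := by
  -- pull `H₂` back along `φ`: `H₁ := φ⁻¹(H₂) = φ.symm(H₂)`
  have hcard₁ : Nat.card ↥(H₂.map φ.symm.toMonoidHom) = q := by rw [card_map_eq, hcard]
  have ht₁ : ∀ P ∈ H₂.map φ.symm.toMonoidHom, tors₁ P :=
    forall_mem_map_tors φ.symm tors₂ tors₁ (fun Q => by rw [← htors, φ.apply_symm_apply]) H₂ ht
  have hs₁ : ∀ a, ∀ P ∈ H₂.map φ.symm.toMonoidHom, act₁ a P ∈ H₂.map φ.symm.toMonoidHom :=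
    forall_mem_map_stable φ.symm act₂ act₁ (fun a Q => by
      apply φ.injective
      rw [φ.apply_symm_apply, ← hact, φ.apply_symm_apply]) H₂ hs
  obtain ⟨β, hβ⟩ := honto _ hcard₁ ht₁ hs₁
  refine ⟨β, ?_⟩
  rw [hβ]
  ext Q
  rw [mem_map_iff_symm_mem, mem_map_iff_symm_mem, MulEquiv.symm_symm, MulEquiv.apply_symm_apply]

/-- **THE HECKE LINES TRANSPORT** ((a)(b)(c) of the spine՚s `HeckeRoofsΩ` at once, conclusion shaped as its conjuncts): a family `β ↦ H_β` of subgroups of `P₁` which is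
injective, of constant order `q`, `tors₁`-valued, `act₁`-stable and onto all such subgroups yields the family `β ↦ φ(H_β)` of subgroups of `P₂` with the same four
properties for `(tors₂, act₂)` — along a multiplicative equivalence `φ` matching torsion and intertwining the endomorphisms.
[cite: Kottwitz1992, §5 (pp. 389–391)] [cite: HarrisTaylorAMS2001, §III.4, pp. 108–110] [cite: RapoportSmithlingZhang2020Diagonal, §4.3 (4.23) p. 21] -/
theorem lines_transport (htors : ∀ P, tors₂ (φ P) ↔ tors₁ P) (hact : ∀ a P, act₂ a (φ P) = φ (act₁ a P)) {q : ℕ} (H : B → Subgroup P₁)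
    (hinj : Function.Injective H)
    (hlines : ∀ β, Nat.card ↥(H β) = q ∧ (∀ P ∈ H β, tors₁ P) ∧ ∀ a, ∀ P ∈ H β, act₁ a P ∈ H β)
    (honto : ∀ H' : Subgroup P₁, Nat.card ↥H' = q → (∀ P ∈ H', tors₁ P) → (∀ a, ∀ P ∈ H', act₁ a P ∈ H') → ∃ β, H β = H') :
    (Function.Injective fun β => (H β).map φ.toMonoidHom) ∧
      (∀ β, Nat.card ↥((H β).map φ.toMonoidHom) = q ∧ (∀ Q ∈ (H β).map φ.toMonoidHom, tors₂ Q) ∧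
        ∀ a, ∀ Q ∈ (H β).map φ.toMonoidHom, act₂ a Q ∈ (H β).map φ.toMonoidHom) ∧
      ∀ H₂ : Subgroup P₂, Nat.card ↥H₂ = q → (∀ Q ∈ H₂, tors₂ Q) → (∀ a, ∀ Q ∈ H₂, act₂ a Q ∈ H₂) →
        ∃ β, (H β).map φ.toMonoidHom = H₂ :=
  ⟨map_injective_family φ H hinj,
    fun β => ⟨(card_map_eq φ (H β)).trans (hlines β).1, forall_mem_map_tors φ tors₁ tors₂ htors (H β) (hlines β).2.1,
      forall_mem_map_stable φ act₁ act₂ hact (H β) (hlines β).2.2⟩,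
    exists_eq_map_of_onto φ tors₁ tors₂ act₁ act₂ htors hact H honto⟩

/-- (d)-rider: `P ∈ H ↔ P ∈ K ∧ tors₁ P` on side 1 gives `Q ∈ φ(H) ↔ Q ∈ φ(K) ∧ tors₂ Q` on side 2. [cite: Kottwitz1992, §5 (pp. 389–391)] -/
theorem mem_map_iff_of_iff_and (htors : ∀ P, tors₂ (φ P) ↔ tors₁ P) (H K : Subgroup P₁) (h : ∀ P, P ∈ H ↔ P ∈ K ∧ tors₁ P) (Q : P₂) :
    Q ∈ H.map φ.toMonoidHom ↔ Q ∈ K.map φ.toMonoidHom ∧ tors₂ Q := by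
  rw [mem_map_iff_symm_mem, mem_map_iff_symm_mem, h, ← htors (φ.symm Q), MulEquiv.apply_symm_apply]

/-- (e)-rider: `P ∈ K ↔ tors₁ P` on side 1 gives `Q ∈ φ(K) ↔ tors₂ Q` on side 2. [cite: Kottwitz1992, §5 (pp. 389–391)] -/
theorem mem_map_iff_of_iff_tors (htors : ∀ P, tors₂ (φ P) ↔ tors₁ P) (K : Subgroup P₁) (h : ∀ P, P ∈ K ↔ tors₁ P) (Q : P₂) :
    Q ∈ K.map φ.toMonoidHom ↔ tors₂ Q := by
  rw [mem_map_iff_symm_mem, h, ← htors (φ.symm Q), MulEquiv.apply_symm_apply]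

/-- The `hK` rider of ★ `roof_transport_along_iso` for `K₂ := φ(K₁)` when `φ⁻¹` IS the point map of `e⁻¹`: `Q ∈ φ(K₁) ↔ f Q ∈ K₁` for any `f` agreeing with `φ.symm`.
[cite: Milne2005ShimuraVarieties, §14 pp. 124–125] -/
theorem mem_map_iff_of_symm_eq (K : Subgroup P₁) (f : P₂ → P₁) (hf : ∀ Q, φ.symm Q = f Q) (Q : P₂) :
    Q ∈ K.map φ.toMonoidHom ↔ f Q ∈ K := by
  rw [mem_map_iff_symm_mem, hf]

end HeckeLines

end Literature.AlgebraicGeometry.AbelianSchemes
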